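import Literature.Computability.ImplicitComplexity.SoftTypeAssignmentLmoRename
import HarnessLib

/-!
# A sharing abstract machine deciding acceptance of `STA₊` programs, I: definition and soundness

GMR08 (= Gaboardi–Marion–Ronchi Della Rocca 2008) proves the NP-soundness of `STA₊` (Thm. 5.12)
with an abstract machine `K_ND` (Table 6) that evaluates a term along the leftmost-outermost
strategy WITHOUT performing substitutions: β-redexes push their argument into a memory context
and variables are looked up when they come in head position (rule `(h)`), the choices `(L)/(R)`
at head sums being the nondeterminism. This sharing is not an optimisation but a necessity: the
explicit leftmost reducts of a typed `STA₊` term can have exponential size (a linear variable may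
occur in every branch of a sum), only the shared representation stays polynomial (GMR08 Lemma
5.10–5.11).

Acceptance of a word by a program is "some `βγ`-normal form of `M s̲` is `0 ≐ λxy.x`"
(Def. 5.13); by the completeness of the leftmost strategy (`reduces_zero_iff_lmoStar`) this is
"the leftmost evaluation with SOME choices ends in `0`", and a leftmost evaluation ending in `0`
never normalises an argument (it consists of head steps under at most two abstractions). The
machine below is therefore a Krivine machine with a choice oracle, extended by two abstract
binder levels, on de Bruijn terms with environments stored in a heap of cells (so that a state
is a first-order object of polynomial size, ready for the polynomial-time implementation):

* `STA.KAM.Entry`, `STA.KAM.State`, `STA.KAM.step`, `STA.KAM.run` — the machine: `push` on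
  applications, `β` = allocate the argument closure and bind it, `enter` an abstraction when the
  stack is empty (at most twice), oracle-driven choice at sums, variable look-up (rule `(h)`), and
  ACCEPT exactly when the head is the variable bound by the outer abstraction, at depth two, with
  empty stack (i.e. the represented term is `0`);
* `STA.KAM.rd` — the term represented by a state (read-back, unfolding the heap);
* `STA.KAM.WF` — well-formedness (pointers go backwards, codes are bound by their environments);
* the stability lemmas of the read-back under more fuel / heap extension.

The soundness of the transitions (`KAM.step_sound`, `KAM.run_sound`: if some oracle makes the
machine accept `T` then `T →βγ* 0`) is `SoftTypeAssignmentMachineSound.lean`; completeness and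
the polynomial bound on the number of transitions follow.

## References

* [GaboardiMarionRonchidellarocca2008] GMR08, §5.1, Table 6 (the machine `K_ND`), Lemma 5.4,
  Def. 5.13.
* P. Crégut, *Strongly reducing variants of the Krivine abstract machine*, HOSC 20 (2007) (de
  Bruijn environments machines).
-/

namespace Literature.Computability.ImplicitComplexity

namespace STA

namespace KAM

/-! ### The machine -/

/-- Heap entries: a closure (code with the list of heap pointers interpreting its free indices),
or the abstract variable of the `ℓ`-th entered abstraction. [cite: GaboardiMarionRonchidellarocca2008, Table 6 (m-contexts)] -/
inductive Entry : Type
  | clo (t : Term) (env : List ℕ)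
  | abs (ℓ : ℕ)

/-- Machine states: code, its environment (heap pointers for the free indices), the argument stack
(closures), the heap, and the number of abstractions entered so far.
[cite: GaboardiMarionRonchidellarocca2008, Table 6 (configurations)] -/
structure State : Type where
  /-- the subterm in head position -/
  code : Term
  /-- heap pointers interpreting the free de Bruijn indices of `code` -/
  env : List ℕ
  /-- pending arguments, as closures -/
  stack : List (Term × List ℕ)
  /-- the heap of bindings -/
  heap : List Entry
  /-- number of abstractions entered (`≤ 2`) -/
  depth : ℕ

/-- Result of one transition. [folklore] -/
inductive Res : Type
  | go (o : List Bool) (s : State)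
  | accept
  | reject

/-- One transition of the machine, consuming an oracle bit at a sum. [cite: GaboardiMarionRonchidellarocca2008, Table 6] -/
def step (o : List Bool) : State → Res
  | ⟨.app t u, env, S, H, D⟩ => .go o ⟨t, env, (u, env) :: S, H, D⟩
  | ⟨.lam t, env, c :: S, H, D⟩ => .go o ⟨t, H.length :: env, S, H ++ [Entry.clo c.1 c.2], D⟩
  | ⟨.lam t, env, [], H, D⟩ =>
    if D < 2 then .go o ⟨t, H.length :: env, [], H ++ [Entry.abs D], D + 1⟩ else .reject
  | ⟨.sum t u, env, S, H, D⟩ =>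
    match o with
    | [] => .reject
    | b :: o' => .go o' ⟨if b then u else t, env, S, H, D⟩
  | ⟨.var i, env, S, H, D⟩ =>
    match env[i]? with
    | none => .reject
    | some c =>
      match H[c]? with
      | some (Entry.clo t env') => .go o ⟨t, env', S, H, D⟩
      | some (Entry.abs ℓ) => if S.isEmpty ∧ D = 2 ∧ ℓ = 0 then .accept else .reject
      | none => .reject

/-- Running the machine with fuel: `true` iff it accepts within `n` transitions. [folklore] -/
def run : ℕ → List Bool → State → Bool
  | 0, _, _ => false
  | n + 1, o, s =>
    match step o s with
    | .accept => true
    | .reject => false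
    | .go o' s' => run n o' s'

/-- The initial state of a term. [folklore] -/
def init (T : Term) : State := ⟨T, [], [], [], 0⟩

/-! ### Read-back -/

/-- Read-back of heap cell `c`, using the cells below `n` only (the recursion is on `n`; in a
well-formed heap a cell refers to earlier cells only). Junk values are the closed term `0`.
[folklore] -/
def rbCell (H : List Entry) (D : ℕ) : ℕ → ℕ → Term
  | 0, _ => zero
  | n + 1, c =>
    if c = n then
      match H[n]? with
      | some (Entry.clo t env) => t.substp fun i => (env[i]?).elim (.var i) fun c' => rbCell H D n c'
      | some (Entry.abs ℓ) => .var (D - 1 - ℓ)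
      | none => zero
    else rbCell H D n c

/-- The substitution interpreting an environment. [folklore] -/
def rbEnv (H : List Entry) (D n : ℕ) (env : List ℕ) : ℕ → Term := fun i =>
  (env[i]?).elim (.var i) fun c => rbCell H D n c

/-- Read-back of a closure. [folklore] -/
def rbClo (H : List Entry) (D n : ℕ) (t : Term) (env : List ℕ) : Term := t.substp (rbEnv H D n env)

/-- `λⁿ t`. [folklore] -/
def lams : ℕ → Term → Term
  | 0, t => t
  | n + 1, t => .lam (lams n t)

/-- `t a₁ ⋯ aₖ`. [folklore] -/
def apps : Term → List Term → Term
  | t, [] => t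
  | t, a :: as => apps (.app t a) as

/-- The term represented by a state. [cite: GaboardiMarionRonchidellarocca2008, Lemma 5.4 (the machine computes βγ-reducts)] -/
def rd (s : State) : Term :=
  lams s.depth (apps (rbClo s.heap s.depth s.heap.length s.code s.env)
    (s.stack.map fun c => rbClo s.heap s.depth s.heap.length c.1 c.2))

/-! ### Well-formed states -/

/-- Well-formedness: environment pointers are allocated, codes are bound by their environments,
heap cells refer backwards, abstract levels are below the depth, the depth is at most two.
[folklore] -/
structure WF (s : State) : Prop where
  envPtr : ∀ c ∈ s.env, c < s.heap.length
  codeFv : ∀ i ∈ s.code.fv, i < s.env.length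
  stackWF : ∀ cl ∈ s.stack, (∀ c ∈ cl.2, c < s.heap.length) ∧ ∀ i ∈ cl.1.fv, i < cl.2.length
  heapClo : ∀ (c : ℕ) (t : Term) (env : List ℕ), s.heap[c]? = some (Entry.clo t env) →
    (∀ c' ∈ env, c' < c) ∧ ∀ i ∈ t.fv, i < env.length
  heapAbs : ∀ (c ℓ : ℕ), s.heap[c]? = some (Entry.abs ℓ) → ℓ < s.depth
  depthLe : s.depth ≤ 2

/-- The initial state of a closed term is well formed. [folklore] -/
theorem WF.init {T : Term} (hT : T.fv = ∅) : WF (init T) where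
  envPtr := by simp [KAM.init]
  codeFv := by simp [KAM.init, hT]
  stackWF := by simp [KAM.init]
  heapClo := by simp [KAM.init]
  heapAbs := by simp [KAM.init]
  depthLe := by simp [KAM.init]

/-! ### Read-back: stability lemmas -/

/-- Cells below `n` read back the same with more fuel. [folklore] -/
theorem rbCell_stable (H : List Entry) (D : ℕ) {c n : ℕ} (h : c < n) : ∀ m, n ≤ m → rbCell H D m c = rbCell H D n c := by
  intro m hm
  induction m with
  | zero => omega
  | succ m ih =>
    rcases Nat.lt_or_ge m n with h1 | h1
    · have : m + 1 = n := by omega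
      rw [this]
    · rw [rbCell, if_neg (by omega), ih h1]

/-- The canonical fuel for a cell. [folklore] -/
theorem rbCell_eq_succ (H : List Entry) (D : ℕ) {c n : ℕ} (h : c < n) : rbCell H D n c = rbCell H D (c + 1) c :=
  rbCell_stable H D (Nat.lt_succ_self c) n h

/-- Reading back a cell does not look beyond it: heap extensions are invisible. [folklore] -/
theorem rbCell_append (H H' : List Entry) (D : ℕ) : ∀ n, n ≤ H.length → ∀ c, rbCell (H ++ H') D n c = rbCell H D n c := by
  intro n
  induction n with
  | zero => intro _ c; rfl
  | succ n ih =>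
    intro hn c
    simp only [rbCell]
    have hget : (H ++ H')[n]? = H[n]? := List.getElem?_append_left (by omega)
    rw [hget]
    by_cases hc : c = n
    · simp only [hc, if_true]
      rcases hH : H[n]? with _ | ⟨t, env⟩ | ℓ
      · rfl
      · simp only
        congr 1
        funext i
        cases env[i]? with
        | none => rfl
        | some c' => exact ih (by omega) c'
      · rfl
    · rw [if_neg hc, if_neg hc, ih (by omega)]

/-- Environments read back the same after a heap extension (fuel within the old heap). [folklore] -/
theorem rbEnv_append (H H' : List Entry) (D : ℕ) {n : ℕ} (hn : n ≤ H.length) (env : List ℕ) :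
    rbEnv (H ++ H') D n env = rbEnv H D n env := by
  funext i
  simp only [rbEnv]
  cases env[i]? with
  | none => rfl
  | some c => exact rbCell_append H H' D n hn c

/-- Environments of allocated pointers read back the same with more fuel. [folklore] -/
theorem rbEnv_stable (H : List Entry) (D : ℕ) {n m : ℕ} (hnm : n ≤ m) {env : List ℕ}
    (henv : ∀ c ∈ env, c < n) : rbEnv H D m env = rbEnv H D n env := by
  funext i
  simp only [rbEnv]
  cases h : env[i]? with
  | none => rfl
  | some c => exact rbCell_stable H D (henv c (List.mem_of_getElem? h)) m hnm

/-- Unfolding the read-back of an allocated closure cell. [folklore] -/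
theorem rbCell_clo {H : List Entry} {D c : ℕ} {t : Term} {env : List ℕ} (h : H[c]? = some (Entry.clo t env)) :
    rbCell H D (c + 1) c = rbClo H D c t env := by
  simp only [rbCell, if_true, h]
  rfl

/-- Unfolding the read-back of an abstract-variable cell. [folklore] -/
theorem rbCell_abs {H : List Entry} {D c ℓ : ℕ} (h : H[c]? = some (Entry.abs ℓ)) :
    rbCell H D (c + 1) c = .var (D - 1 - ℓ) := by
  simp [rbCell, h]

/-- `λᴰ (λ t) = λᴰ⁺¹ t`. [folklore] -/
theorem lams_lam (D : ℕ) (t : Term) : lams D (.lam t) = lams (D + 1) t := by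
  induction D with
  | zero => rfl
  | succ D ih => simp [lams, ih]

/-- A substitution followed by a single substitution for the new index `0`. [folklore] -/
theorem substp_up_subst0 (t N : Term) (σ : ℕ → Term) :
    (t.substp (Term.up σ)).subst0 N = t.substp (fun i => match i with | 0 => N | i + 1 => σ i) := by
  rw [Term.subst0, Term.substp_substp]
  refine congrArg (fun τ => t.substp τ) (funext fun i => ?_)
  cases i with
  | zero => rfl
  | succ i =>
    show ((σ i).rename Nat.succ).substp _ = σ i
    rw [Term.substp_rename]
    exact Term.substp_var (σ i)

end KAM

end STA

end Literature.Computability.ImplicitComplexity
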